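import Mathlib
import Summits.NavierStokesRegularity.NavierStokesRegularity.Theses.EulerZoomLiouville
import Summits.NavierStokesRegularity.NavierStokesRegularity.Theorems.EulerZoomLiouvillePowerGaugeEulerLiouvilleSelfSimilarProfileMember
import Summits.NavierStokesRegularity.NavierStokesRegularity.Theorems.EulerZoomLiouvillePowerGaugeEulerLiouvilleClockTransferTranslate
import HarnessLib

/-!
# THE CRUX IMPLIES THE PROFILE LIOUVILLE THEOREM: `PowerGaugeEulerLiouville` ⇒ every `C²` CIV profile pair with finite own-rate weights at infinity is trivial
# (crux `EulerZoomLiouville.PowerGaugeEulerLiouville` = stmt-NavierStokesRegularity-19832, line `birth` — refuter/planner dictionary)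

Route `EulerZoomLiouville` (NavierStokesRegularity); width seat ns-ezl-w6 g2 (LEAD ns-typeII-p2 g12).  By PROFILE ⇒ MEMBER (`ProfileMember.exists_inClass_of_profile`,
p642180) a `C²` solution `(V, P′)` of CIV (3.3) on `ℝ³` with exponent `γ = 1/(2+ρ)`, `0 < ρ < 1`, and finite own-rate weights at infinity
(`∫_{B_L}‖V‖² ≤ N L^{1−2ρ}` for `L ≥ 1`, `∫_{‖y‖≥1}|∇V|²_F‖y‖^{ρ−1} < ∞`, `∫_{‖y‖≥1}|P′|^{3/2}‖y‖^{2ρ−2} < ∞`) generates a member of the crux's class; so IF the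
crux `PowerGaugeEulerLiouville` holds, the member vanishes a.e. and `V = 0` (`ClockTransfer.profile_eq_zero_of_ae_eq_zero`):
`ProfileMember.profile_eq_zero_of_powerGaugeEulerLiouville`.  Contrapositive (not stated as a theorem, to keep the refutation lane to refuters): ONE nontrivial
such pair for ONE `ρ ∈ (0, 1)` refutes the crux — the typed form of cdisprove's D1/D2 targets and of the route's KILL CRITERIA («an α-self-similar
local-energy Euler collapse profile»), now with the EXACT membership conditions (three numbers at infinity; nothing at the core).
WHAT THIS IS NOT: not NS, not E — a dictionary lemma (`--supports` stmt-19832); no profile is constructed or excluded here; 19832 OPEN. [folklore]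
-/

noncomputable section

-- flat `Theorems/<Route><Decl>…` files of one crux share the namespace of the crux (tree convention: `Summit.<S>.<S>.…`)
set_option linter.dupNamespace false

open MeasureTheory Set Filter Topology Metric Function TopologicalSpace
open scoped ENNReal NNReal

namespace Summit.NavierStokesRegularity.NavierStokesRegularity.Theorems.PowerGaugeEulerLiouville

open Literature.Analysis Literature.Analysis.FunctionSpaces Literature.Analysis.FluidPDE

namespace ProfileMember

/-- **THE CRUX IMPLIES THE PROFILE LIOUVILLE THEOREM.**  If `PowerGaugeEulerLiouville` holds, then for every `0 < ρ < 1` every `C²` solution `(V, P′)` of CIV (3.3)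
on `ℝ³` with exponent `1/(2+ρ)` and finite own-rate weights at infinity has `V = 0`. [folklore] -/
theorem profile_eq_zero_of_powerGaugeEulerLiouville
    (hcrux : Summit.NavierStokesRegularity.NavierStokesRegularity.Theses.EulerZoomLiouville.PowerGaugeEulerLiouville)
    {ρ : ℝ} (hρ : 0 < ρ) (hρ1 : ρ < 1)
    {V : EuclideanSpace ℝ (Fin 3) → EuclideanSpace ℝ (Fin 3)} {P : EuclideanSpace ℝ (Fin 3) → ℝ}
    (hprof : IsSelfSimilarEulerProfile (1 / (2 + ρ)) 0 V P) {N : ℝ≥0}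
    (hA : ∀ L : ℝ, 1 ≤ L →
      ∫⁻ y in ball (0 : EuclideanSpace ℝ (Fin 3)) L, ‖V y‖ₑ ^ 2 ≤ (N : ℝ≥0∞) * ENNReal.ofReal (L ^ (1 - 2 * ρ)))
    (hE : ∫⁻ y in {y : EuclideanSpace ℝ (Fin 3) | 1 ≤ ‖y‖},
      ENNReal.ofReal (frobeniusNormSq (fderiv ℝ V y)) * ENNReal.ofReal (‖y‖ ^ (ρ - 1)) ≠ ⊤)
    (hD : ∫⁻ y in {y : EuclideanSpace ℝ (Fin 3) | 1 ≤ ‖y‖}, ‖P y‖ₑ ^ (3 / 2 : ℝ) * ENNReal.ofReal (‖y‖ ^ (2 * ρ - 2)) ≠ ⊤) :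
    V = 0 := by
  obtain ⟨c, hsw, hH, hg⟩ := exists_inClass_of_profile (by linarith) hρ1 hprof hA hE hD
  have h0 := hcrux ρ hρ _ _ _ c hsw hH hg
  exact ClockTransfer.profile_eq_zero_of_ae_eq_zero hprof.contDiff_velocity.continuous (fun _ _ => rfl) h0

/-- **Equivalently: under the crux, the pressure profile of such a pair is constant** (`∇P′ = −(1−γ)V − DV[γy+V] = 0`). [folklore] -/
theorem pressure_const_of_powerGaugeEulerLiouville
    (hcrux : Summit.NavierStokesRegularity.NavierStokesRegularity.Theses.EulerZoomLiouville.PowerGaugeEulerLiouville)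
    {ρ : ℝ} (hρ : 0 < ρ) (hρ1 : ρ < 1)
    {V : EuclideanSpace ℝ (Fin 3) → EuclideanSpace ℝ (Fin 3)} {P : EuclideanSpace ℝ (Fin 3) → ℝ}
    (hprof : IsSelfSimilarEulerProfile (1 / (2 + ρ)) 0 V P) {N : ℝ≥0}
    (hA : ∀ L : ℝ, 1 ≤ L →
      ∫⁻ y in ball (0 : EuclideanSpace ℝ (Fin 3)) L, ‖V y‖ₑ ^ 2 ≤ (N : ℝ≥0∞) * ENNReal.ofReal (L ^ (1 - 2 * ρ)))
    (hE : ∫⁻ y in {y : EuclideanSpace ℝ (Fin 3) | 1 ≤ ‖y‖},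
      ENNReal.ofReal (frobeniusNormSq (fderiv ℝ V y)) * ENNReal.ofReal (‖y‖ ^ (ρ - 1)) ≠ ⊤)
    (hD : ∫⁻ y in {y : EuclideanSpace ℝ (Fin 3) | 1 ≤ ‖y‖}, ‖P y‖ₑ ^ (3 / 2 : ℝ) * ENNReal.ofReal (‖y‖ ^ (2 * ρ - 2)) ≠ ⊤) :
    ∀ y, P y = P 0 := by
  have hV := profile_eq_zero_of_powerGaugeEulerLiouville hcrux hρ hρ1 hprof hA hE hD
  have hd : Differentiable ℝ P := hprof.differentiable_pressure
  have hgrad : ∀ y, fderiv ℝ P y = 0 := by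
    intro y
    have e := hprof.profile_eq y
    rw [hV] at e
    simp only [Pi.zero_apply, smul_zero, zero_add] at e
    have : gradient P y = 0 := by simpa using e
    have := congrArg (InnerProductSpace.toDual ℝ (EuclideanSpace ℝ (Fin 3))) this
    simpa [gradient] using this
  intro y
  exact is_const_of_fderiv_eq_zero hd hgrad y 0

end ProfileMember

end Summit.NavierStokesRegularity.NavierStokesRegularity.Theorems.PowerGaugeEulerLiouville
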